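import Literature.Geometry.Lorentzian.TeukolskyWronskianBoundProofs
import Literature.Geometry.Lorentzian.TeukolskyStarobinskyHeun
import Literature.Analysis.ODE.LinearSecondOrder
import HarnessLib

/-!
# The radial Teukolsky ODE as a regular linear ODE on `(r₊, ∞)`: normal form, Cauchy data,
# continuation from a half-line, and vanishing of rapidly decaying solutions (`s = 0`)

Namespace `Literature.Geometry.Lorentzian.Kerr.Costa2019`. Elementary ODE bookkeeping for the homogeneous
radial Teukolsky equation `Δ R″ + 2(s+1)(r − M) R′ + V R = 0` on `(r₊, ∞)`
(`Kerr.IsRadialTeukolskySolution`, Teixeira da Costa arXiv:1910.02854 §2.2.3), used to build the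
solution normalised at `𝓘⁺` (`TeukolskyNormalisedInfinityExists.lean`):

* `radialNFp`, `radialNFq` — the normal form `R″ = p R′ + q R` (`p = −2(s+1)(r−M)/Δ`, `q = −V/Δ`,
  continuous on `(r₊, ∞)`: `continuousOn_radialNF`), and the passage between the two formats
  (`normalForm_of_radial`, `isRadialTeukolskySolution_of_normalForm`);
* `exists_radial_of_data` — a solution with prescribed Cauchy data at `t₀ > r₊`
  (`Literature.Analysis.ODE.exists_solution_Ioi`); `radial_extend` — a solution on a half-line `(X, ∞)`,
  `X ≥ r₊`, is the restriction of a solution on `(r₊, ∞)` (uniqueness, `eqOn_of_solution_Ioo`);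
* `delta_mul_wronskian_eq` — for `s = 0`, `Δ (y₁ y₂′ − y₁′ y₂)` is constant (TdC Remark 5.1,
  `radialWronskian_eq`);
* `radial_eq_zero_of_decay` — for `s = 0`, `M > 0`, `|a| < M`, `ω ≠ 0` there is an exponent `p₀ ≥ 0` such
  that every solution `Z` with `|Z|, |Z′| ≤ C r^{−q}`, `q ≥ p₀ + 3`, VANISHES: its Wronskians with a basis
  of polynomially growing solutions (`exists_rpow_bound_of_isRadialTeukolskySolution`) are constant and tend
  to `0`, so its Cauchy data vanish (`radial_eq_zero_of_data`). (On the real axis both normal solutions at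
  the rank-one irregular singular point `r = ∞` have modulus `≍ r^{−1}`, so nothing decays faster; this is the
  uniqueness half of the asymptotic-expansion theorem, Olver Ch. 7 §2.)

Everything is proved; folklore over the tree's vocabulary.

## References
* R. Teixeira da Costa, CMP 378 (2020) 705–781 = arXiv:1910.02854, §2.2.3, Remark 5.1. [Costa2019]
* P. Hartman, *Ordinary Differential Equations*, SIAM Classics 38 (2002), Ch. IV §§1, 8. [Hartman2002]
-/

noncomputable section

open Complex Set Filter Topology

namespace Literature.Geometry.Lorentzian.Kerr

namespace Costa2019

/-! ### The normal form -/

/-- `p = −2(s+1)(r − M)/Δ`, the coefficient of `R′` in the normal form `R″ = p R′ + q R`.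
[cite: Costa2019, §2.2.3 (radial ODE)] -/
def radialNFp (M a s : ℝ) (r : ℝ) : ℂ := -(2 * ((s + 1 : ℝ) : ℂ) * ((r - M : ℝ) : ℂ)) / (delta M a r : ℂ)

/-- The potential coefficient `V` of `R` in `Δ R″ + 2(s+1)(r−M) R′ + V R = 0` (verbatim from
`Kerr.IsRadialTeukolskySolution`). [cite: Costa2019, §2.2.3 (radial ODE)] -/
def radialV (M a s ω m lam : ℝ) (r : ℝ) : ℂ :=
  (((radialK a ω m r ^ 2 : ℝ) : ℂ) - 2 * I * (s : ℂ) * ((r - M : ℝ) : ℂ) * (radialK a ω m r : ℂ)) /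
      (delta M a r : ℂ) +
    4 * I * (s : ℂ) * (ω : ℂ) * (r : ℂ) - (lam : ℂ) - ((a ^ 2 * ω ^ 2 : ℝ) : ℂ) + ((2 * a * m * ω : ℝ) : ℂ)

/-- `q = −V/Δ`, the coefficient of `R` in the normal form. [cite: Costa2019, §2.2.3 (radial ODE)] -/
def radialNFq (M a s ω m lam : ℝ) (r : ℝ) : ℂ := -radialV M a s ω m lam r / (delta M a r : ℂ)

/-- Continuity of `p`, `q` on `(r₊, ∞)` (`|a| ≤ M`). [folklore] -/
theorem continuousOn_radialNF {M a : ℝ} (ha : |a| ≤ M) (s ω m lam : ℝ) :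
    ContinuousOn (radialNFp M a s) (Ioi (rPlus M a)) ∧ ContinuousOn (radialNFq M a s ω m lam) (Ioi (rPlus M a)) := by
  have hΔ0 : ∀ r ∈ Ioi (rPlus M a), (delta M a r : ℂ) ≠ 0 := fun r hr => by
    exact_mod_cast (delta_pos ha hr).ne'
  have hΔc : Continuous fun r : ℝ => (delta M a r : ℂ) :=
    Complex.continuous_ofReal.comp (show Continuous fun r : ℝ => r ^ 2 - 2 * M * r + a ^ 2 by fun_prop)
  have hK1 : Continuous (radialK a ω m) := show Continuous fun r : ℝ => ω * (r ^ 2 + a ^ 2) - a * m by fun_prop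
  have hKc : Continuous fun r => (radialK a ω m r : ℂ) := Complex.continuous_ofReal.comp hK1
  have hK2c : Continuous fun r => ((radialK a ω m r ^ 2 : ℝ) : ℂ) := Complex.continuous_ofReal.comp (hK1.pow 2)
  have hrM : Continuous fun r : ℝ => ((r - M : ℝ) : ℂ) :=
    Complex.continuous_ofReal.comp (continuous_id.sub continuous_const)
  have hrc : Continuous fun r : ℝ => (r : ℂ) := Complex.continuous_ofReal
  have hVc : ContinuousOn (radialV M a s ω m lam) (Ioi (rPlus M a)) := by
    unfold radialV
    refine ContinuousOn.add (ContinuousOn.sub (ContinuousOn.sub (ContinuousOn.add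
      (ContinuousOn.div ?_ hΔc.continuousOn hΔ0) ?_) continuousOn_const) continuousOn_const) continuousOn_const
    · exact (hK2c.sub ((continuous_const.mul hrM).mul hKc)).continuousOn
    · exact (continuous_const.mul hrc).continuousOn
  refine ⟨?_, hVc.neg.div hΔc.continuousOn hΔ0⟩
  unfold radialNFp
  exact (continuous_const.mul hrM).neg.continuousOn.div hΔc.continuousOn hΔ0

/-- From the radial ODE (given with `R′, R″`) to the normal form `R″ = p R′ + q R` on `(r₊, ∞)`. [folklore] -/
theorem normalForm_of_radial {M a s ω m lam : ℝ} (ha : |a| ≤ M) {R R' R'' : ℝ → ℂ}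
    (hR : ∀ r : ℝ, rPlus M a < r → HasDerivAt R (R' r) r ∧ HasDerivAt R' (R'' r) r ∧
      (delta M a r : ℂ) * R'' r + 2 * ((s + 1 : ℝ) : ℂ) * ((r - M : ℝ) : ℂ) * R' r + radialV M a s ω m lam r * R r = 0) :
    ∀ t ∈ Ioi (rPlus M a), HasDerivAt R (R' t) t ∧
      HasDerivAt R' (radialNFp M a s t * R' t + radialNFq M a s ω m lam t * R t) t := by
  intro t ht
  obtain ⟨h1, h2, h3⟩ := hR t ht
  have hΔ : (delta M a t : ℂ) ≠ 0 := by exact_mod_cast (delta_pos ha ht).ne'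
  have e : R'' t = radialNFp M a s t * R' t + radialNFq M a s ω m lam t * R t := by
    unfold radialNFp radialNFq
    field_simp
    linear_combination h3
  exact ⟨h1, e ▸ h2⟩

/-- From the normal form on `(r₊, ∞)` to `Kerr.IsRadialTeukolskySolution`. [folklore] -/
theorem isRadialTeukolskySolution_of_normalForm {M a s ω m lam : ℝ} (ha : |a| ≤ M) {R R' : ℝ → ℂ}
    (hR : ∀ t ∈ Ioi (rPlus M a), HasDerivAt R (R' t) t ∧
      HasDerivAt R' (radialNFp M a s t * R' t + radialNFq M a s ω m lam t * R t) t) :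
    IsRadialTeukolskySolution M a s ω m lam R := by
  refine ⟨R', fun t => radialNFp M a s t * R' t + radialNFq M a s ω m lam t * R t, fun r hr => ?_⟩
  refine ⟨(hR r hr).1, (hR r hr).2, ?_⟩
  have hΔ : (delta M a r : ℂ) ≠ 0 := by exact_mod_cast (delta_pos ha hr).ne'
  show (delta M a r : ℂ) * (radialNFp M a s r * R' r + radialNFq M a s ω m lam r * R r) +
      2 * ((s + 1 : ℝ) : ℂ) * ((r - M : ℝ) : ℂ) * R' r + radialV M a s ω m lam r * R r = 0
  unfold radialNFp radialNFq
  field_simp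
  ring

/-! ### Cauchy data and continuation -/

/-- **A radial solution with prescribed Cauchy data** `(R, R′)(t₀) = (c₀, c₁)` at `t₀ > r₊`, in normal
form on `(r₊, ∞)`. [cite: Hartman2002, Ch. IV Lemma 1.1] -/
theorem exists_radial_of_data {M a : ℝ} (ha : |a| ≤ M) (s ω m lam : ℝ) (t₀ : ℝ) (c₀ c₁ : ℂ) :
    ∃ R R' : ℝ → ℂ, R t₀ = c₀ ∧ R' t₀ = c₁ ∧ ∀ t ∈ Ioi (rPlus M a), HasDerivAt R (R' t) t ∧
      HasDerivAt R' (radialNFp M a s t * R' t + radialNFq M a s ω m lam t * R t) t := by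
  obtain ⟨hp, hq⟩ := continuousOn_radialNF ha s ω m lam
  exact Literature.Analysis.ODE.exists_solution_Ioi hp hq t₀ c₀ c₁

/-- **Continuation from a half-line.** A normal-form solution on `(X, ∞)`, `X ≥ r₊`, agrees there with a
normal-form solution on all of `(r₊, ∞)` (continue the Cauchy data at `X + 1`; uniqueness on `(X, b)`).
[cite: Hartman2002, Ch. IV Lemma 1.1] -/
theorem radial_extend {M a : ℝ} (ha : |a| ≤ M) (s ω m lam : ℝ) {X : ℝ} (hX : rPlus M a ≤ X) {R R' : ℝ → ℂ}
    (hR : ∀ t ∈ Ioi X, HasDerivAt R (R' t) t ∧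
      HasDerivAt R' (radialNFp M a s t * R' t + radialNFq M a s ω m lam t * R t) t) :
    ∃ S S' : ℝ → ℂ, (∀ t ∈ Ioi (rPlus M a), HasDerivAt S (S' t) t ∧
      HasDerivAt S' (radialNFp M a s t * S' t + radialNFq M a s ω m lam t * S t) t) ∧
      EqOn R S (Ioi X) ∧ EqOn R' S' (Ioi X) := by
  obtain ⟨S, S', h0, h1, hS⟩ := exists_radial_of_data ha s ω m lam (X + 1) (R (X + 1)) (R' (X + 1))
  obtain ⟨hp, hq⟩ := continuousOn_radialNF ha s ω m lam
  refine ⟨S, S', hS, ?_, ?_⟩ <;> intro t ht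
  all_goals
    have hsub : Ioo X (max t (X + 1) + 1) ⊆ Ioi (rPlus M a) := fun x hx => hX.trans_lt hx.1
    have hsub' : Ioo X (max t (X + 1) + 1) ⊆ Ioi X := fun x hx => hx.1
    have h := Literature.Analysis.ODE.eqOn_of_solution_Ioo (hp.mono hsub) (hq.mono hsub)
      (t₀ := X + 1) ⟨by linarith, by linarith [le_max_right t (X + 1)]⟩
      (fun x hx => hR x (hsub' hx)) (fun x hx => hS x (hsub hx)) h0.symm h1.symm
    have htI : t ∈ Ioo X (max t (X + 1) + 1) := ⟨ht, by linarith [le_max_left t (X + 1)]⟩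
  · exact h.1 htI
  · exact h.2 htI

/-! ### The Wronskian (`s = 0`) -/

/-- **`Δ · (y₁ y₂′ − y₁′ y₂)` is constant** along two normal-form solutions with `s = 0` (TdC Remark 5.1
with `Δ^{1+0} = Δ`). [cite: Costa2019, Remark 5.1] -/
theorem delta_mul_wronskian_eq {M a ω m lam : ℝ} (ha : |a| ≤ M) {y₁ y₁' y₂ y₂' : ℝ → ℂ}
    (h₁ : ∀ t ∈ Ioi (rPlus M a), HasDerivAt y₁ (y₁' t) t ∧
      HasDerivAt y₁' (radialNFp M a 0 t * y₁' t + radialNFq M a 0 ω m lam t * y₁ t) t)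
    (h₂ : ∀ t ∈ Ioi (rPlus M a), HasDerivAt y₂ (y₂' t) t ∧
      HasDerivAt y₂' (radialNFp M a 0 t * y₂' t + radialNFq M a 0 ω m lam t * y₂ t) t)
    {t t₀ : ℝ} (ht : rPlus M a < t) (ht₀ : rPlus M a < t₀) :
    (delta M a t : ℂ) * (y₁ t * y₂' t - y₁' t * y₂ t) = (delta M a t₀ : ℂ) * (y₁ t₀ * y₂' t₀ - y₁' t₀ * y₂ t₀) := by
  have hW := radialWronskian_eq ha (isRadialTeukolskySolution_of_normalForm ha h₁)
    (isRadialTeukolskySolution_of_normalForm ha h₂) ht ht₀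
  rw [radialWronskian_apply, radialWronskian_apply, (h₁ t ht).1.deriv, (h₂ t ht).1.deriv, (h₁ t₀ ht₀).1.deriv,
    (h₂ t₀ ht₀).1.deriv, show (1 : ℝ) + 0 = 1 by norm_num, Real.rpow_one, Real.rpow_one] at hW
  linear_combination hW

/-! ### Rapidly decaying solutions vanish (`s = 0`) -/

/-- `Δ(t) ≤ (1 + a²) t²` for `t ≥ 1` (`M ≥ 0`). [folklore] -/
theorem delta_le_sq {M a t : ℝ} (hM : 0 ≤ M) (ht : 1 ≤ t) : delta M a t ≤ (1 + a ^ 2) * t ^ 2 := by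
  unfold delta
  have h1 : a ^ 2 * 1 ≤ a ^ 2 * t ^ 2 := mul_le_mul_of_nonneg_left (by nlinarith) (sq_nonneg a)
  nlinarith [mul_nonneg hM (zero_le_one.trans ht)]

/-- **RAPIDLY DECAYING SOLUTIONS VANISH (`s = 0`, real `ω ≠ 0`).** For `M > 0`, `|a| < M`, `ω ≠ 0` there is
`p₀ ≥ 0` (a growth exponent of a basis of solutions, `exists_rpow_bound_of_isRadialTeukolskySolution`) such
that every classical radial solution `Z` with `‖Z(r)‖, ‖Z′(r)‖ ≤ C r^{−q}` for `r ≥ X`, `q ≥ p₀ + 3`,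
vanishes identically on `(r₊, ∞)`: the Wronskians `Δ(Z yᵢ′ − yᵢ Z′)` with the basis are constant and
`O(r^{2 + p₀ − q}) → 0`, hence zero, so `Z` has zero Cauchy data. [cite: Costa2019, Remark 5.1] -/
theorem radial_eq_zero_of_decay {M a : ℝ} (hM : 0 < M) (ha : |a| < M) {ω : ℝ} (hω : ω ≠ 0) (m lam : ℝ) :
    ∃ p₀ : ℝ, 0 ≤ p₀ ∧ ∀ (Z : ℝ → ℂ) (C X q : ℝ), p₀ + 3 ≤ q → IsRadialTeukolskySolution M a 0 ω m lam Z →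
      (∀ r, X ≤ r → ‖Z r‖ ≤ C * r ^ (-q) ∧ ‖deriv Z r‖ ≤ C * r ^ (-q)) → ∀ r, rPlus M a < r → Z r = 0 := by
  set t₀ : ℝ := rPlus M a + 1 with ht₀
  have ht₀p : rPlus M a < t₀ := by rw [ht₀]; linarith
  -- the basis with data `(1, 0)`, `(0, 1)` at `t₀`
  obtain ⟨y₁, y₁', h10, h11, hy₁⟩ := exists_radial_of_data ha.le 0 ω m lam t₀ 1 0
  obtain ⟨y₂, y₂', h20, h21, hy₂⟩ := exists_radial_of_data ha.le 0 ω m lam t₀ 0 1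
  have hs₁ := isRadialTeukolskySolution_of_normalForm ha.le hy₁
  have hs₂ := isRadialTeukolskySolution_of_normalForm ha.le hy₂
  obtain ⟨X₁, C₁, p₁, -, hX₁, hC₁, hp₁, hb₁⟩ :=
    exists_rpow_bound_of_isRadialTeukolskySolution hM ha hω hs₁ fun r hr => (hy₁ r hr).1
  obtain ⟨X₂, C₂, p₂, -, hX₂, hC₂, hp₂, hb₂⟩ :=
    exists_rpow_bound_of_isRadialTeukolskySolution hM ha hω hs₂ fun r hr => (hy₂ r hr).1
  refine ⟨max p₁ p₂, le_max_of_le_left hp₁, fun Z C X q hq hZ hb r hr => ?_⟩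
  obtain ⟨Z', Z'', hZ3⟩ := hZ
  have hZd : ∀ t, rPlus M a < t → deriv Z t = Z' t := fun t ht => (hZ3 t ht).1.deriv
  have hC : 0 ≤ C := by
    have h := (hb (max X 1) (le_max_left _ _)).1
    exact (mul_nonneg_iff_of_pos_right (Real.rpow_pos_of_pos (by positivity) _)).1 ((norm_nonneg _).trans h)
  -- the two Wronskians vanish
  have key : ∀ (y y' : ℝ → ℂ) (Cy py Xy : ℝ), 1 ≤ Xy → py ≤ max p₁ p₂ → 0 ≤ Cy →
      (∀ t ∈ Ioi (rPlus M a), HasDerivAt y (y' t) t ∧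
        HasDerivAt y' (radialNFp M a 0 t * y' t + radialNFq M a 0 ω m lam t * y t) t) →
      (∀ r, Xy ≤ r → ‖y r‖ ≤ Cy * r ^ py ∧ ‖y' r‖ ≤ Cy * r ^ py) →
      (delta M a t₀ : ℂ) * (Z t₀ * y' t₀ - y t₀ * Z' t₀) = 0 := by
    intro y y' Cy py Xy hXy hpy hCy hy hby
    have hsZ : IsRadialTeukolskySolution M a 0 ω m lam Z := ⟨Z', Z'', hZ3⟩
    have hsy := isRadialTeukolskySolution_of_normalForm ha.le hy
    refine eq_zero_of_norm_le_div (B := (1 + a ^ 2) * (2 * C * Cy)) (X := max (max X Xy) (rPlus M a + 1))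
      fun t ht => ?_
    have htX : X ≤ t := (le_max_left _ _).trans ((le_max_left _ _).trans ht)
    have htXy : Xy ≤ t := (le_max_right _ _).trans ((le_max_left _ _).trans ht)
    have ht1 : 1 ≤ t := hXy.trans htXy
    have ht0 : 0 < t := by linarith
    have htp : rPlus M a < t := by linarith [le_max_right (max X Xy) (rPlus M a + 1)]
    -- constancy of the Wronskian
    have hW := radialWronskian_eq ha.le hsZ hsy ht₀p htp
    rw [radialWronskian_apply, radialWronskian_apply, hZd t₀ ht₀p, hZd t htp, (hy t₀ ht₀p).1.deriv,
      (hy t htp).1.deriv, show (1 : ℝ) + 0 = 1 by norm_num, Real.rpow_one, Real.rpow_one] at hW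
    rw [hW, norm_mul, Complex.norm_real, Real.norm_of_nonneg (delta_pos ha.le htp).le]
    -- sizes at `t`
    obtain ⟨hZt, hZ't⟩ := hb t htX
    rw [hZd t htp] at hZ't
    obtain ⟨hyt, hy't⟩ := hby t htXy
    have hΔ : delta M a t ≤ (1 + a ^ 2) * t ^ 2 := delta_le_sq hM.le ht1
    have h1 : ‖Z t * y' t - y t * Z' t‖ ≤ 2 * C * Cy * (t ^ (-q) * t ^ py) := by
      calc ‖Z t * y' t - y t * Z' t‖ ≤ ‖Z t‖ * ‖y' t‖ + ‖y t‖ * ‖Z' t‖ := by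
            refine (norm_sub_le _ _).trans ?_; rw [norm_mul, norm_mul]
        _ ≤ C * t ^ (-q) * (Cy * t ^ py) + Cy * t ^ py * (C * t ^ (-q)) :=
            add_le_add (mul_le_mul hZt hy't (norm_nonneg _) (by positivity))
              (mul_le_mul hyt hZ't (norm_nonneg _) (by positivity))
        _ = 2 * C * Cy * (t ^ (-q) * t ^ py) := by ring
    have h2 : t ^ 2 * (t ^ (-q) * t ^ py) ≤ t⁻¹ := by
      rw [← Real.rpow_natCast, ← Real.rpow_add ht0, ← Real.rpow_add ht0, ← Real.rpow_neg_one]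
      exact Real.rpow_le_rpow_of_exponent_le ht1 (by push_cast; linarith)
    calc delta M a t * ‖Z t * y' t - y t * Z' t‖ ≤ (1 + a ^ 2) * t ^ 2 * (2 * C * Cy * (t ^ (-q) * t ^ py)) :=
          mul_le_mul hΔ h1 (norm_nonneg _) (by positivity)
      _ = (1 + a ^ 2) * (2 * C * Cy) * (t ^ 2 * (t ^ (-q) * t ^ py)) := by ring
      _ ≤ (1 + a ^ 2) * (2 * C * Cy) * t⁻¹ := mul_le_mul_of_nonneg_left h2 (by positivity)
      _ = (1 + a ^ 2) * (2 * C * Cy) / t := by rw [div_eq_mul_inv]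
  have hΔ0 : (delta M a t₀ : ℂ) ≠ 0 := by exact_mod_cast (delta_pos ha.le ht₀p).ne'
  have k₁ := key y₁ y₁' C₁ p₁ X₁ hX₁ (le_max_left _ _) hC₁ hy₁ hb₁
  have k₂ := key y₂ y₂' C₂ p₂ X₂ hX₂ (le_max_right _ _) hC₂ hy₂ hb₂
  rw [h10, h11] at k₁
  rw [h20, h21] at k₂
  have hZ0 : Z t₀ = 0 := by simpa [hΔ0] using k₂
  have hZ1 : Z' t₀ = 0 := by simpa [hΔ0] using k₁
  exact ((radial_eq_zero_of_data ha.le hZ3 ht₀p hZ0 hZ1) r hr).1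

end Costa2019

end Literature.Geometry.Lorentzian.Kerr

end
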